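import Summits.CriticalPhenomena.PercolationContinuityZ3.Theorems.PercNearOneGluingAdditiveGluingBlockPockets
import Summits.CriticalPhenomena.PercolationContinuityZ3.Theorems.PercNearOneGluingAdditiveGluingToolGainIdentity
import HarnessLib

/-! # Crux `PercNearOneGluing.AdditiveGluing` (stmt-CriticalPhenomena-4576), line `peel` — the SIGNED-CONFIGURATION
# (corner) form of the block kernel, general `n` (peel cell, strategy (d) "generalise the certificates")

Support file (`--supports stmt-CriticalPhenomena-4576`); no definitions, no named facts.

`μ = prodBernoulli u` on the bond configurations of `Fin n`; relays `A ∋ b, a₀`; a block `S ≠ ∅`; `X = ⋃_{s∈S} {a₀ ↔ s}`,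
`Y = ⋃_{s∈S} {s ↔ b}`; `K_S(ω) = {z | S ↔ z}` the cluster of the block, `{K_S = W}` its fibres, `dead = {K_S ∩ A = ∅}`
(`∀ a ∈ A, S ↮ a`); `sel : Finset → Fin n` a pocket selection with `sel W ∈ A`; `E_sel = {ω | sel (K_S ω) ↔ b}`.
The block kernel (block goodness, `hker` of `goodStep24_main`, conclusion of `stub_conePeel`) is
`BG :  μ(a₀↔b) + μ(a₀↮b, X, Y) ≤ μ(Y) + Σ_{W ∩ A = ∅} μ(K_S = W) · μ(sel W ↔ b in Wᶜ)`.

The exact n = 6–8 certificates of the crux (ttrl exactslack / route (a) corner census: at every 0/1 corner the kernel functional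
takes a value in `{−1, 0, +1}`, the value `−1` occurring only where `hmin` fails) instantiate the following IDENTITIES, valid for
every weighting, every `n`, every block and every selection:
* `kernelCorner_lhs_eq` (event algebra of the glued two-point function):
  `μ(a₀↔b) + μ(a₀↮b, X, Y) = μ(Y) − μ(Y ∩ Xᶜ) + μ(a₀↔b ∩ Xᶜ)`;
* `kernelCorner_threeTerm` (**conditional normal form**): `RHS − LHS = μ(S↔b, a₀↮S) + μ(dead ∩ E_sel) − μ(a₀↔b, a₀↮S)` —
  the kernel says that, on `{a₀ ↮ S}`, the glued block beats the designated relay up to the dead-pocket credit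
  (the block analogue of the comparison in Kozma–Nitzan's Lemma 5);
* `kernelCorner_signed` (**signed-configuration form**): `RHS − LHS = μ(G₁) + μ(G₂) − μ(B₁) − μ(B₂)` with the GOOD events
  `G₁ = {S↔b} ∩ {a₀↮S}`, `G₂ = dead ∩ E_sel ∩ {a₀↮b}` and the BAD events `B₁ = {a₀↔b} ∩ {a₀↮S} ∩ deadᶜ`,
  `B₂ = dead ∩ {a₀↔b} ∩ E_selᶜ` — at a 0/1 corner `μ` is a point mass and this is the census value `±1 / 0`;
* `kernelCorner_bad_subset` / `kernelCorner_bad_le`: every BAD configuration violates `hmin` deterministically —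
  `B₁ ∪ B₂ ⊆ ⋃_{a∈A} {a₀↔b} ∩ {a↮b}`, hence `μ(B₁ ∪ B₂) ≤ Σ_{a∈A} μ(a₀↔b, a↮b)`;
* `blockGood_iff_cornerComparison`: `BG ⟺ μ(B₁) + μ(B₂) ≤ μ(G₁) + μ(G₂)`.
Tools: the pocket Markov property `blockPocket_mul_offConn` and the fibre sum `blockPocket_sum_dead` (seat sp), finite measure algebra.
[cite: KozmaNitzan2024, §3.2 Definition p. 12, Lemma 5 p. 13, proof of Thm 5 p. 14]
-/

namespace Summit.CriticalPhenomena.PercolationContinuityZ3.Theorems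

open MeasureTheory Set
open Literature.Probability.LatticeModels (prodBernoulli)
open Literature.Probability.Percolation (BondConfig openConn openConnIn openGraph openCluster)
open scoped BigOperators Classical

noncomputable section

section KernelCornerForm

open Literature.Probability.LatticeModels Literature.Probability.Percolation

variable {n : ℕ}

/-- `{a₀↔b} ∩ X = Y ∩ X ∩ {a₀↔b}`: if `a₀ ↔ b` and `a₀ ↔ s` then `s ↔ b`. [folklore] -/
theorem kernelCorner_conn_inter_X (S : Finset (Fin n)) (b a₀ : Fin n) :
    ((openConn a₀ b : Set (BondConfig (Fin n))) ∩ (⋃ s ∈ S, openConn a₀ s)) =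
      (⋃ s ∈ S, openConn s b) ∩ (⋃ s ∈ S, openConn a₀ s) ∩ openConn a₀ b := by
  ext ω
  simp only [Set.mem_inter_iff, Set.mem_iUnion, exists_prop, toolGain_mem_openConn]
  constructor
  · rintro ⟨hab, s, hs, has⟩
    exact ⟨⟨⟨s, hs, has.symm.trans hab⟩, s, hs, has⟩, hab⟩
  · rintro ⟨⟨-, hX⟩, hab⟩
    exact ⟨hab, hX⟩

/-- **Event algebra of the glued two-point function**:
`μ(a₀↔b) + μ(a₀↮b, X, Y) = μ(Y) − μ(Y ∩ Xᶜ) + μ(a₀↔b ∩ Xᶜ)`. [cite: KozmaNitzan2024, §3.1 Remark p. 5, §3.2 p. 13] -/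
theorem kernelCorner_lhs_eq (u : Sym2 (Fin n) → unitInterval) (S : Finset (Fin n)) (b a₀ : Fin n) :
    (prodBernoulli u).real (openConn a₀ b)
        + (prodBernoulli u).real ((openConn a₀ b)ᶜ ∩ (⋃ s ∈ S, openConn a₀ s) ∩ (⋃ s ∈ S, openConn s b))
      = (prodBernoulli u).real (⋃ s ∈ S, openConn s b)
        - (prodBernoulli u).real ((⋃ s ∈ S, openConn s b) ∩ (⋃ s ∈ S, openConn a₀ s)ᶜ)
        + (prodBernoulli u).real (openConn a₀ b ∩ (⋃ s ∈ S, openConn a₀ s)ᶜ) := by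
  have h1 := toolGain_inter_split u (openConn a₀ b : Set (BondConfig (Fin n))) (⋃ s ∈ S, openConn a₀ s)
  have h2 := toolGain_inter_split u (⋃ s ∈ S, (openConn s b : Set (BondConfig (Fin n)))) (⋃ s ∈ S, openConn a₀ s)
  have h3 := toolGain_inter_split u ((⋃ s ∈ S, (openConn s b : Set (BondConfig (Fin n)))) ∩ (⋃ s ∈ S, openConn a₀ s))
    (openConn a₀ b)
  have e1 := kernelCorner_conn_inter_X S b a₀
  have e2 : ((openConn a₀ b : Set (BondConfig (Fin n)))ᶜ ∩ (⋃ s ∈ S, openConn a₀ s) ∩ (⋃ s ∈ S, openConn s b)) =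
      (⋃ s ∈ S, openConn s b) ∩ (⋃ s ∈ S, openConn a₀ s) ∩ (openConn a₀ b)ᶜ := by
    ext ω
    simp only [Set.mem_inter_iff, Set.mem_compl_iff]
    tauto
  rw [e1] at h1
  rw [e2, h1, h2, h3]
  ring

/-- On the fibre `{K_S = W}` the selected relay is `sel W`: `{K_S = W} ∩ {sel W ↔ b} = {K_S = W} ∩ E_sel`. [folklore] -/
theorem kernelCorner_fibre_inter_sel (S W : Finset (Fin n)) (b : Fin n) (sel : Finset (Fin n) → Fin n) :
    ({ω : BondConfig (Fin n) | ∀ z : Fin n, (z ∈ W ↔ ω ∈ ⋃ s ∈ S, openConn s z)} ∩ openConn (sel W) b) =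
      {ω : BondConfig (Fin n) | ∀ z : Fin n, (z ∈ W ↔ ω ∈ ⋃ s ∈ S, openConn s z)} ∩
        {ω : BondConfig (Fin n) |
          ω ∈ openConn (sel (Finset.univ.filter fun z : Fin n => ω ∈ ⋃ s ∈ S, openConn s z)) b} := by
  ext ω
  simp only [Set.mem_inter_iff, Set.mem_setOf_eq]
  constructor
  · rintro ⟨hW, hb⟩
    have hKW : (Finset.univ.filter fun z : Fin n => ω ∈ ⋃ s ∈ S, openConn s z) = W := by
      ext z
      simp only [Finset.mem_filter, Finset.mem_univ, true_and]
      exact (hW z).symm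
    rw [hKW]
    exact ⟨hW, hb⟩
  · rintro ⟨hW, hb⟩
    have hKW : (Finset.univ.filter fun z : Fin n => ω ∈ ⋃ s ∈ S, openConn s z) = W := by
      ext z
      simp only [Finset.mem_filter, Finset.mem_univ, true_and]
      exact (hW z).symm
    rw [hKW] at hb
    exact ⟨hW, hb⟩

/-- **The dead-pocket credit as ONE event**: for `S ≠ ∅` and a selection with values in `A`,
`Σ_{W ∩ A = ∅} μ(K_S = W) · μ(sel W ↔ b in Wᶜ) = μ(dead ∩ E_sel)`.
[cite: KozmaNitzan2024, §3.2 (proof of Thm 5, p. 14: Markov property of pockets)] -/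
theorem kernelCorner_pocketSum_eq (u : Sym2 (Fin n) → unitInterval) (A S : Finset (Fin n)) (b : Fin n)
    (sel : Finset (Fin n) → Fin n) (hS : S.Nonempty) (hsel : ∀ W, sel W ∈ A) :
    ∑ W ∈ (Finset.univ : Finset (Finset (Fin n))).filter (fun W => Disjoint W A),
        (prodBernoulli u).real {ω : BondConfig (Fin n) | ∀ z : Fin n, (z ∈ W ↔ ω ∈ ⋃ s ∈ S, openConn s z)}
          * (prodBernoulli u).real (openConnIn ((W : Set (Fin n))ᶜ) (sel W) b)
      = (prodBernoulli u).real ({ω : BondConfig (Fin n) | ∀ a ∈ A, ω ∉ ⋃ s ∈ S, openConn s a} ∩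
          {ω : BondConfig (Fin n) |
            ω ∈ openConn (sel (Finset.univ.filter fun z : Fin n => ω ∈ ⋃ s ∈ S, openConn s z)) b}) := by
  rw [Set.inter_comm, ← blockPocket_sum_dead u S A]
  refine Finset.sum_congr rfl fun W hW => ?_
  have hWA : Disjoint W A := (Finset.mem_filter.1 hW).2
  have hselW : sel W ∉ W := fun h => Finset.disjoint_left.1 hWA h (hsel W)
  rw [blockPocket_mul_offConn u S W hS (sel W) b hselW, kernelCorner_fibre_inter_sel S W b sel]

/-- **CONDITIONAL NORMAL FORM of the block kernel** (general `n`, every weighting, every block `S ≠ ∅`, every selection with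
values in `A`):  `RHS − LHS = μ(S↔b ∩ a₀↮S) + μ(dead ∩ E_sel) − μ(a₀↔b ∩ a₀↮S)`.
So block goodness says: on `{a₀ ↮ S}` the glued block is at least as likely to reach `b` as `a₀`, up to the dead-pocket
credit — the block analogue of the comparison in Kozma–Nitzan's Lemma 5. [cite: KozmaNitzan2024, §3.2 Lemma 5 p. 13, p. 14] -/
theorem kernelCorner_threeTerm (u : Sym2 (Fin n) → unitInterval) (A S : Finset (Fin n)) (b a₀ : Fin n)
    (sel : Finset (Fin n) → Fin n) (hS : S.Nonempty) (hsel : ∀ W, sel W ∈ A) :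
    (prodBernoulli u).real (⋃ s ∈ S, openConn s b)
        + ∑ W ∈ (Finset.univ : Finset (Finset (Fin n))).filter (fun W => Disjoint W A),
            (prodBernoulli u).real {ω : BondConfig (Fin n) | ∀ z : Fin n, (z ∈ W ↔ ω ∈ ⋃ s ∈ S, openConn s z)}
              * (prodBernoulli u).real (openConnIn ((W : Set (Fin n))ᶜ) (sel W) b)
        - ((prodBernoulli u).real (openConn a₀ b)
            + (prodBernoulli u).real ((openConn a₀ b)ᶜ ∩ (⋃ s ∈ S, openConn a₀ s) ∩ (⋃ s ∈ S, openConn s b)))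
      = (prodBernoulli u).real ((⋃ s ∈ S, openConn s b) ∩ (⋃ s ∈ S, openConn a₀ s)ᶜ)
        + (prodBernoulli u).real ({ω : BondConfig (Fin n) | ∀ a ∈ A, ω ∉ ⋃ s ∈ S, openConn s a} ∩
            {ω : BondConfig (Fin n) |
              ω ∈ openConn (sel (Finset.univ.filter fun z : Fin n => ω ∈ ⋃ s ∈ S, openConn s z)) b})
        - (prodBernoulli u).real (openConn a₀ b ∩ (⋃ s ∈ S, openConn a₀ s)ᶜ) := by
  rw [kernelCorner_pocketSum_eq u A S b sel hS hsel, kernelCorner_lhs_eq u S b a₀]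
  ring

/-- A dead configuration misses the designated relay: `dead ⊆ Xᶜ` (for `a₀ ∈ A`). [folklore] -/
theorem kernelCorner_dead_subset_notX (A S : Finset (Fin n)) (a₀ : Fin n) (ha₀ : a₀ ∈ A) :
    {ω : BondConfig (Fin n) | ∀ a ∈ A, ω ∉ ⋃ s ∈ S, openConn s a} ⊆ (⋃ s ∈ S, openConn a₀ s)ᶜ := by
  intro ω hω hX
  obtain ⟨s, hs, has⟩ := Set.mem_iUnion₂.1 hX
  exact hω a₀ ha₀ (Set.mem_iUnion₂.2 ⟨s, hs, (show (openGraph ω).Reachable a₀ s from has).symm⟩)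

/-- **SIGNED-CONFIGURATION (corner) FORM of the block kernel** (general `n`): with `G₁ = {S↔b} ∩ {a₀↮S}`,
`G₂ = dead ∩ E_sel ∩ {a₀↮b}`, `B₁ = {a₀↔b} ∩ {a₀↮S} ∩ deadᶜ`, `B₂ = dead ∩ {a₀↔b} ∩ E_selᶜ`:
`RHS − LHS = μ(G₁) + μ(G₂) − μ(B₁) − μ(B₂)`.  At a 0/1 corner `μ` is a point mass, so the kernel functional is `+1` on
`G₁ ∪ G₂`, `−1` on `B₁ ∪ B₂` and `0` elsewhere — the general form of the exact corner census of the n = 6 class.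
[cite: KozmaNitzan2024, §3.2 Definition p. 12, pp. 13–14] -/
theorem kernelCorner_signed (u : Sym2 (Fin n) → unitInterval) (A S : Finset (Fin n)) (b a₀ : Fin n)
    (sel : Finset (Fin n) → Fin n) (hS : S.Nonempty) (ha₀ : a₀ ∈ A) (hsel : ∀ W, sel W ∈ A) :
    (prodBernoulli u).real (⋃ s ∈ S, openConn s b)
        + ∑ W ∈ (Finset.univ : Finset (Finset (Fin n))).filter (fun W => Disjoint W A),
            (prodBernoulli u).real {ω : BondConfig (Fin n) | ∀ z : Fin n, (z ∈ W ↔ ω ∈ ⋃ s ∈ S, openConn s z)}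
              * (prodBernoulli u).real (openConnIn ((W : Set (Fin n))ᶜ) (sel W) b)
        - ((prodBernoulli u).real (openConn a₀ b)
            + (prodBernoulli u).real ((openConn a₀ b)ᶜ ∩ (⋃ s ∈ S, openConn a₀ s) ∩ (⋃ s ∈ S, openConn s b)))
      = (prodBernoulli u).real ((⋃ s ∈ S, openConn s b) ∩ (⋃ s ∈ S, openConn a₀ s)ᶜ)
        + (prodBernoulli u).real ({ω : BondConfig (Fin n) | ∀ a ∈ A, ω ∉ ⋃ s ∈ S, openConn s a} ∩
            {ω : BondConfig (Fin n) |
              ω ∈ openConn (sel (Finset.univ.filter fun z : Fin n => ω ∈ ⋃ s ∈ S, openConn s z)) b} ∩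
            (openConn a₀ b)ᶜ)
        - (prodBernoulli u).real (openConn a₀ b ∩ (⋃ s ∈ S, openConn a₀ s)ᶜ ∩
            {ω : BondConfig (Fin n) | ∀ a ∈ A, ω ∉ ⋃ s ∈ S, openConn s a}ᶜ)
        - (prodBernoulli u).real ({ω : BondConfig (Fin n) | ∀ a ∈ A, ω ∉ ⋃ s ∈ S, openConn s a} ∩
            openConn a₀ b ∩
            {ω : BondConfig (Fin n) |
              ω ∈ openConn (sel (Finset.univ.filter fun z : Fin n => ω ∈ ⋃ s ∈ S, openConn s z)) b}ᶜ) := by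
  rw [kernelCorner_threeTerm u A S b a₀ sel hS hsel]
  set D : Set (BondConfig (Fin n)) := {ω | ∀ a ∈ A, ω ∉ ⋃ s ∈ S, openConn s a} with hD
  set E : Set (BondConfig (Fin n)) :=
    {ω | ω ∈ openConn (sel (Finset.univ.filter fun z : Fin n => ω ∈ ⋃ s ∈ S, openConn s z)) b} with hE
  -- split the loss term along `dead`
  have h1 := toolGain_inter_split u ((openConn a₀ b : Set (BondConfig (Fin n))) ∩ (⋃ s ∈ S, openConn a₀ s)ᶜ) D
  have e1 : ((openConn a₀ b : Set (BondConfig (Fin n))) ∩ (⋃ s ∈ S, openConn a₀ s)ᶜ ∩ D) = D ∩ openConn a₀ b := by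
    ext ω
    simp only [Set.mem_inter_iff]
    constructor
    · rintro ⟨⟨hab, -⟩, hd⟩; exact ⟨hd, hab⟩
    · rintro ⟨hd, hab⟩; exact ⟨⟨hab, kernelCorner_dead_subset_notX A S a₀ ha₀ hd⟩, hd⟩
  rw [e1] at h1
  -- split the credit along `{a₀↔b}` and the dead loss along `E_sel`
  have h2 := toolGain_inter_split u (D ∩ E) (openConn a₀ b)
  have h3 := toolGain_inter_split u (D ∩ openConn a₀ b) E
  have e2 : (D ∩ E ∩ openConn a₀ b : Set (BondConfig (Fin n))) = D ∩ openConn a₀ b ∩ E := Set.inter_right_comm _ _ _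
  rw [e2] at h2
  rw [h1, h2, h3]
  ring

/-- **Every BAD configuration violates `hmin` deterministically**: on `B₁ ∪ B₂` some relay `a ∈ A` is cut from `b` while
`a₀ ↔ b` (on `B₁`: a relay swallowed by the block's cluster, which misses `b`; on `B₂`: the selected relay).
[cite: KozmaNitzan2024, §3.2 pp. 12–14] -/
theorem kernelCorner_bad_subset (A S : Finset (Fin n)) (b a₀ : Fin n) (sel : Finset (Fin n) → Fin n)
    (hsel : ∀ W, sel W ∈ A) :
    ((openConn a₀ b : Set (BondConfig (Fin n))) ∩ (⋃ s ∈ S, openConn a₀ s)ᶜ ∩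
          {ω : BondConfig (Fin n) | ∀ a ∈ A, ω ∉ ⋃ s ∈ S, openConn s a}ᶜ
        ∪ ({ω : BondConfig (Fin n) | ∀ a ∈ A, ω ∉ ⋃ s ∈ S, openConn s a} ∩ openConn a₀ b ∩
          {ω : BondConfig (Fin n) |
            ω ∈ openConn (sel (Finset.univ.filter fun z : Fin n => ω ∈ ⋃ s ∈ S, openConn s z)) b}ᶜ))
      ⊆ ⋃ a ∈ A, ((openConn a₀ b : Set (BondConfig (Fin n))) ∩ (openConn a b)ᶜ) := by
  rintro ω (⟨⟨hab, hX⟩, hD⟩ | ⟨⟨-, hab⟩, hE⟩)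
  · simp only [Set.mem_compl_iff, Set.mem_setOf_eq, not_forall, not_not, exists_prop] at hD
    obtain ⟨a, ha, haK⟩ := hD
    obtain ⟨s, hs, hsa⟩ := Set.mem_iUnion₂.1 haK
    refine Set.mem_iUnion₂.2 ⟨a, ha, hab, fun hab' => hX (Set.mem_iUnion₂.2 ⟨s, hs, ?_⟩)⟩
    exact (show (openGraph ω).Reachable a₀ b from hab).trans
      (((show (openGraph ω).Reachable s a from hsa).trans hab').symm)
  · exact Set.mem_iUnion₂.2 ⟨_, hsel _, hab, hE⟩

/-- Hence `μ(B₁ ∪ B₂) ≤ Σ_{a∈A} μ(a₀↔b ∩ a↮b)` — zero at every 0/1 corner where `hmin` holds.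
[cite: KozmaNitzan2024, §3.2 pp. 12–14] -/
theorem kernelCorner_bad_le (u : Sym2 (Fin n) → unitInterval) (A S : Finset (Fin n)) (b a₀ : Fin n)
    (sel : Finset (Fin n) → Fin n) (hsel : ∀ W, sel W ∈ A) :
    (prodBernoulli u).real
        ((openConn a₀ b : Set (BondConfig (Fin n))) ∩ (⋃ s ∈ S, openConn a₀ s)ᶜ ∩
            {ω : BondConfig (Fin n) | ∀ a ∈ A, ω ∉ ⋃ s ∈ S, openConn s a}ᶜ
          ∪ ({ω : BondConfig (Fin n) | ∀ a ∈ A, ω ∉ ⋃ s ∈ S, openConn s a} ∩ openConn a₀ b ∩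
            {ω : BondConfig (Fin n) |
              ω ∈ openConn (sel (Finset.univ.filter fun z : Fin n => ω ∈ ⋃ s ∈ S, openConn s z)) b}ᶜ))
      ≤ ∑ a ∈ A, (prodBernoulli u).real ((openConn a₀ b : Set (BondConfig (Fin n))) ∩ (openConn a b)ᶜ) :=
  (measureReal_mono (kernelCorner_bad_subset A S b a₀ sel hsel) (measure_ne_top _ _)).trans
    (measureReal_biUnion_finset_le A fun a => (openConn a₀ b : Set (BondConfig (Fin n))) ∩ (openConn a b)ᶜ)

/-- **Block goodness is a comparison of two event probabilities**: `BG(u, A, S, b, a₀, sel) ⟺ μ(B₁) + μ(B₂) ≤ μ(G₁) + μ(G₂)`.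
[cite: KozmaNitzan2024, §3.2 Definition p. 12] -/
theorem blockGood_iff_cornerComparison (u : Sym2 (Fin n) → unitInterval) (A S : Finset (Fin n)) (b a₀ : Fin n)
    (sel : Finset (Fin n) → Fin n) (hS : S.Nonempty) (ha₀ : a₀ ∈ A) (hsel : ∀ W, sel W ∈ A) :
    ((prodBernoulli u).real (openConn a₀ b)
          + (prodBernoulli u).real ((openConn a₀ b)ᶜ ∩ (⋃ s ∈ S, openConn a₀ s) ∩ (⋃ s ∈ S, openConn s b))
        ≤ (prodBernoulli u).real (⋃ s ∈ S, openConn s b)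
          + ∑ W ∈ (Finset.univ : Finset (Finset (Fin n))).filter (fun W => Disjoint W A),
              (prodBernoulli u).real {ω : BondConfig (Fin n) | ∀ z : Fin n, (z ∈ W ↔ ω ∈ ⋃ s ∈ S, openConn s z)}
                * (prodBernoulli u).real (openConnIn ((W : Set (Fin n))ᶜ) (sel W) b)) ↔
      ((prodBernoulli u).real (openConn a₀ b ∩ (⋃ s ∈ S, openConn a₀ s)ᶜ ∩
            {ω : BondConfig (Fin n) | ∀ a ∈ A, ω ∉ ⋃ s ∈ S, openConn s a}ᶜ)
          + (prodBernoulli u).real ({ω : BondConfig (Fin n) | ∀ a ∈ A, ω ∉ ⋃ s ∈ S, openConn s a} ∩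
              openConn a₀ b ∩
              {ω : BondConfig (Fin n) |
                ω ∈ openConn (sel (Finset.univ.filter fun z : Fin n => ω ∈ ⋃ s ∈ S, openConn s z)) b}ᶜ)
        ≤ (prodBernoulli u).real ((⋃ s ∈ S, openConn s b) ∩ (⋃ s ∈ S, openConn a₀ s)ᶜ)
          + (prodBernoulli u).real ({ω : BondConfig (Fin n) | ∀ a ∈ A, ω ∉ ⋃ s ∈ S, openConn s a} ∩
              {ω : BondConfig (Fin n) |
                ω ∈ openConn (sel (Finset.univ.filter fun z : Fin n => ω ∈ ⋃ s ∈ S, openConn s z)) b} ∩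
              (openConn a₀ b)ᶜ)) := by
  have h := kernelCorner_signed u A S b a₀ sel hS ha₀ hsel
  constructor <;> intro h' <;> linarith

/-! ### Registered stubs of the peel cell, strategy (d) (suffix `_pd`) -/

/-- Registered stub `stub_kernelThreeTerm_pd` (peel cell (d)): the conditional normal form `kernelCorner_threeTerm`, ∀-closed.
[cite: KozmaNitzan2024, §3.2 Lemma 5 p. 13, p. 14] -/
theorem stub_kernelThreeTerm_pd : ∀ (n : ℕ) (u : Sym2 (Fin n) → unitInterval) (A S : Finset (Fin n)) (b a₀ : Fin n) (sel : Finset (Fin n) → Fin n), S.Nonempty → (∀ W, sel W ∈ A) → (prodBernoulli u).real (⋃ s ∈ S, openConn s b) + (∑ W ∈ (Finset.univ : Finset (Finset (Fin n))).filter (fun W => Disjoint W A), (prodBernoulli u).real {ω : BondConfig (Fin n) | ∀ z : Fin n, (z ∈ W ↔ ω ∈ ⋃ s ∈ S, openConn s z)} * (prodBernoulli u).real (openConnIn ((W : Set (Fin n))ᶜ) (sel W) b)) - ((prodBernoulli u).real (openConn a₀ b) + (prodBernoulli u).real ((openConn a₀ b)ᶜ ∩ (⋃ s ∈ S, openConn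 a₀ s) ∩ (⋃ s ∈ S, openConn s b))) = (prodBernoulli u).real ((⋃ s ∈ S, openConn s b) ∩ (⋃ s ∈ S, openConn a₀ s)ᶜ) + (prodBernoulli u).real ({ω : BondConfig (Fin n) | ∀ a ∈ A, ω ∉ ⋃ s ∈ S, openConn s a} ∩ {ω : BondConfig (Fin n) | ω ∈ openConn (sel (Finset.univ.filter fun z : Fin n => ω ∈ ⋃ s ∈ S, openConn s z)) b}) - (prodBernoulli u).real (openConn a₀ b ∩ (⋃ s ∈ S, openConn a₀ s)ᶜ) :=
  fun _ u A S b a₀ sel hS hsel => kernelCorner_threeTerm u A S b a₀ sel hS hsel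

/-- Registered stub `stub_kernelCornerSigned_pd` (peel cell (d)): the signed-configuration form `kernelCorner_signed`, ∀-closed.
[cite: KozmaNitzan2024, §3.2 Definition p. 12, pp. 13–14] -/
theorem stub_kernelCornerSigned_pd : ∀ (n : ℕ) (u : Sym2 (Fin n) → unitInterval) (A S : Finset (Fin n)) (b a₀ : Fin n) (sel : Finset (Fin n) → Fin n), S.Nonempty → a₀ ∈ A → (∀ W, sel W ∈ A) → (prodBernoulli u).real (⋃ s ∈ S, openConn s b) + (∑ W ∈ (Finset.univ : Finset (Finset (Fin n))).filter (fun W => Disjoint W A), (prodBernoulli u).real {ω : BondConfig (Fin n) | ∀ z : Fin n, (z ∈ W ↔ ω ∈ ⋃ s ∈ S, openConn s z)} * (prodBernoulli u).real (openConnIn ((W : Set (Fin n))ᶜ) (sel W) b)) - ((prodBernoulli u).real (openConn a₀ b) + (prodBernoulli u).real ((openConn a₀ b)ᶜ ∩ (⋃ s ∈ S, openConn a₀ s) ∩ (⋃ s ∈ S, openConn s b))) = (prodBernoulli u).real ((⋃ s ∈ S, openConn s b) ∩ (⋃ s ∈ S, openConn a₀ s)ᶜ) + (prodBernoulli u).real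 ({ω : BondConfig (Fin n) | ∀ a ∈ A, ω ∉ ⋃ s ∈ S, openConn s a} ∩ {ω : BondConfig (Fin n) | ω ∈ openConn (sel (Finset.univ.filter fun z : Fin n => ω ∈ ⋃ s ∈ S, openConn s z)) b} ∩ (openConn a₀ b)ᶜ) - (prodBernoulli u).real (openConn a₀ b ∩ (⋃ s ∈ S, openConn a₀ s)ᶜ ∩ {ω : BondConfig (Fin n) | ∀ a ∈ A, ω ∉ ⋃ s ∈ S, openConn s a}ᶜ) - (prodBernoulli u).real ({ω : BondConfig (Fin n) | ∀ a ∈ A, ω ∉ ⋃ s ∈ S, openConn s a} ∩ openConn a₀ b ∩ {ω : BondConfig (Fin n) | ω ∈ openConn (sel (Finset.univ.filter fun z : Fin n => ω ∈ ⋃ s ∈ S, openConn s z)) b}ᶜ) :=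
  fun _ u A S b a₀ sel hS ha₀ hsel => kernelCorner_signed u A S b a₀ sel hS ha₀ hsel

/-- Registered stub `stub_kernelBadCorners_pd` (peel cell (d)): every BAD configuration violates `hmin`, `kernelCorner_bad_le` ∀-closed.
[cite: KozmaNitzan2024, §3.2 pp. 12–14] -/
theorem stub_kernelBadCorners_pd : ∀ (n : ℕ) (u : Sym2 (Fin n) → unitInterval) (A S : Finset (Fin n)) (b a₀ : Fin n) (sel : Finset (Fin n) → Fin n), (∀ W, sel W ∈ A) → (prodBernoulli u).real ((openConn a₀ b : Set (BondConfig (Fin n))) ∩ (⋃ s ∈ S, openConn a₀ s)ᶜ ∩ {ω : BondConfig (Fin n) | ∀ a ∈ A, ω ∉ ⋃ s ∈ S, openConn s a}ᶜ ∪ ({ω : BondConfig (Fin n) | ∀ a ∈ A, ω ∉ ⋃ s ∈ S, openConn s a} ∩ openConn a₀ b ∩ {ω : BondConfig (Fin n) | ω ∈ openConn (sel (Finset.univ.filter fun z : Fin n => ω ∈ ⋃ s ∈ S, openConn s z)) b}ᶜ)) ≤ ∑ a ∈ A, (prodBernoulli u).real ((openConn a₀ b : Set (BondConfig (Fin n)))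 ∩ (openConn a b)ᶜ) :=
  fun _ u A S b a₀ sel hsel => kernelCorner_bad_le u A S b a₀ sel hsel

end KernelCornerForm

end

end Summit.CriticalPhenomena.PercolationContinuityZ3.Theorems
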